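import Literature.Claims.NS.Kaliyeva2014
import Literature.Analysis.FunctionSpaces.TorusClassicalNSUniqueness
import HarnessLib

/-!
# C180 `Kaliyeva2014` — SALVAGE (a) TRUE column: the UNIQUENESS conjunct of Theorem 2 (and of Theorem 1)
# holds for the typed classical class — `claimedTheorem_uniqueness_holds`

Cell `ns-claims` (D-0090), lane ns-claims-salvage-p6 g5 (filer + SALVAGE of record, CHAIR 20:49:58Z; the row
in hand under RULINGS v1.57); records-grade TRUE-column object (no binder of `claim_of_steps` is refuted or
replaced; head / class are the refuters' and the chair's). Text of record: K. Kaliyeva, A. Kaliyev, WCE 2014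
Vol II pp. 1288–1293, Theorem 2 p.1292 «… there exists a UNIQUE unstable periodic solution of the
Navier–Stokes problem (1)–(3)» and Theorem 1 p.1292 «… a unique stable periodic solution …». The skeleton
`Literature.Claims.NS.Kaliyeva2014` types the claim over CLASSICAL solutions on `[0,∞) × 𝕋³`
(`IsSolution ν f u₀ u p := Torus.IsClassicalNSSolutionOn (Ici 0) ν f u p ∧ u 0 = u₀`) as
`(existence) ∧ (velocity uniqueness)`. The second conjunct is a theorem of the tree for EVERY smooth
datum and EVERY force (curl-free or not): two classical solutions on the convex time set `[0,∞)` with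
the same viscosity `ν ≥ 0`, the same force and the same datum agree — Majda–Bertozzi 2002, Cor. 3.1, as
`Literature.Analysis.FunctionSpaces.Torus.IsClassicalNSSolutionOn.velocity_unique_of_mem`. The existence
conjunct (a global classical solution for every smooth periodic datum and every smooth force) is
Clay (B)-strength and is NOT asserted here.

WHAT THIS IS NOT: not a claim about NS regularity or blow-up; not a claim about any author beyond the
typed locator.
-/

set_option linter.dupNamespace false

noncomputable section

open Set

namespace Summit.NavierStokesRegularity.NavierStokesRegularity.Theorems.Kaliyeva2014

open Literature.Analysis.FunctionSpaces Literature.Claims.NS.Kaliyeva2014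

/-- **Velocity uniqueness for the typed class (any force, any `ν ≥ 0`)**: two solutions of (1)–(3) on
`[0,∞) × 𝕋³` in the sense of `IsSolution` with the same datum have the same velocity at every `t ≥ 0`
(Majda–Bertozzi 2002 Cor. 3.1 on the torus, tree `Torus.IsClassicalNSSolutionOn.velocity_unique_of_mem`
with `S = Ici 0`, anchor `t₀ = 0`). [cite: Kaliyeva2014, Thm 2 p.1292 («unique»)] [cite: MajdaBertozziCUP2002, Cor. 3.1] -/
theorem isSolution_velocity_unique {ν : ℝ} (hν : 0 ≤ ν) {f : ℝ → T3 → E3} {u₀ : T3 → E3}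
    {u u' : ℝ → T3 → E3} {p p' : ℝ → T3 → ℝ} (hu : IsSolution ν f u₀ u p)
    (hu' : IsSolution ν f u₀ u' p') {t : ℝ} (ht : 0 ≤ t) : u t = u' t :=
  Torus.IsClassicalNSSolutionOn.velocity_unique_of_mem hν (convex_Ici 0) hu.1 hu'.1
    (t₀ := 0) (mem_Ici.2 le_rfl) (hu.2.trans hu'.2.symm) (mem_Ici.2 ht) ht

/-- **The UNIQUENESS conjunct of Theorem 2 p.1292 HOLDS** for the typed classical class: for every
`ν > 0`, every datum and every force (the hypothesis `rot f⃗ ≠ 0` is not needed), any two solutions of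
(1)–(3) from the same datum have the same velocity on `[0,∞)`. The EXISTENCE conjunct of
`ClaimedTheorem` is not asserted. [cite: Kaliyeva2014, Thm 2 p.1292] [cite: MajdaBertozziCUP2002, Cor. 3.1] -/
theorem claimedTheorem_uniqueness_holds :
    ∀ ν : ℝ, 0 < ν → ∀ u₀ : T3 → E3, IsDatum u₀ → ∀ f : ℝ → T3 → E3, IsForce f → RotNonzero f →
      ∀ (u u' : ℝ → T3 → E3) (p p' : ℝ → T3 → ℝ),
        IsSolution ν f u₀ u p → IsSolution ν f u₀ u' p' → ∀ t : ℝ, 0 ≤ t → u t = u' t :=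
  fun _ν hν _u₀ _ _f _ _ _u _u' _p _p' hu hu' _t ht => isSolution_velocity_unique hν.le hu hu' ht

/-- **The UNIQUENESS conjunct of Theorem 1 p.1292 HOLDS** likewise (curl-free datum and force: the
hypotheses are not needed for uniqueness). [cite: Kaliyeva2014, Thm 1 p.1292] [cite: MajdaBertozziCUP2002, Cor. 3.1] -/
theorem theorem1Face_uniqueness_holds :
    ∀ ν : ℝ, 0 < ν → ∀ u₀ : T3 → E3, IsDatum u₀ → RotZero u₀ → ∀ f : ℝ → T3 → E3, IsForce f →
      (∀ t : ℝ, 0 ≤ t → RotZero (f t)) →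
      ∀ (u u' : ℝ → T3 → E3) (p p' : ℝ → T3 → ℝ),
        IsSolution ν f u₀ u p → IsSolution ν f u₀ u' p' → ∀ t : ℝ, 0 ≤ t → u t = u' t :=
  fun _ν hν _u₀ _ _ _f _ _ _u _u' _p _p' hu hu' _t ht => isSolution_velocity_unique hν.le hu hu' ht

/-- Hence `ClaimedTheorem` reduces to its EXISTENCE conjunct: if for every `ν > 0`, datum and force with
`rot f⃗ ≠ 0` a solution of (1)–(3) on `[0,∞)` exists, Theorem 2 as typed follows. (Records: the
existence conjunct is Clay (B)-strength with force; nothing asserts it.) [cite: Kaliyeva2014, Thm 2 p.1292] -/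
theorem claimedTheorem_of_existence
    (hex : ∀ ν : ℝ, 0 < ν → ∀ u₀ : T3 → E3, IsDatum u₀ → ∀ f : ℝ → T3 → E3, IsForce f →
      RotNonzero f → ∃ (u : ℝ → T3 → E3) (p : ℝ → T3 → ℝ), IsSolution ν f u₀ u p) :
    ClaimedTheorem :=
  fun ν hν u₀ hu₀ f hf hrot =>
    ⟨hex ν hν u₀ hu₀ f hf hrot, claimedTheorem_uniqueness_holds ν hν u₀ hu₀ f hf hrot⟩

end Summit.NavierStokesRegularity.NavierStokesRegularity.Theorems.Kaliyeva2014

end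

-- WHAT THIS IS NOT: not a claim about NS regularity or blow-up; not a claim about any author beyond the typed locator.
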